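import Literature.AlgebraicGeometry.ModuliOfAbelianVarieties.SiegelLevelOneFactorisation
import Literature.AlgebraicGeometry.ModuliOfAbelianVarieties.SiegelAdelicMarkingRationalMove
import Literature.AlgebraicGeometry.ModuliOfAbelianVarieties.SiegelAdelicCongrTransport
import HarnessLib

/-!
# Transport of a level-one marking to a principal representative: `[J(Z₀), a₀]` with frame `k₀` ↦ `[J(M⁻¹•Z₀), r_c]`
# with the SAME level-`N` readings ([Milne 2005] Lemma 5.13 / Thm. 6.11; [Deligne 1971] 4.16)

Topic `AlgebraicGeometry/ModuliOfAbelianVarieties`; namespace `Literature.AlgebraicGeometry.ModuliOfAbelianVarieties`.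
KERNEL ONLY: theorems; no definition, no named fact, no instance, no `sorry`.  Cell `hodgecm-mathlib`, U-DAG brick B4 (c)
FILE 2 (B-p03 CENSUS-B4 §2 (c); B-plan1 R50; director s109), over FILE 1 ★ `SiegelLevelOneFactorisation`
(`k₀ = M_𝔸 · r · k`, `M ∈ Sp_δ(ℤ)`, `r = diag(1, u·1)`, `k ∈ K_δ(N)`).

Situation (B4 = existence half of (U)): a complex abelian variety `A` is marked by `[J(Z₀), a₀]`, `a₀ ∈ K_δ(1)` (★ B4 (a)
`exists_siegelAdelicMarking`), and the given (liftable) level structure reads, through that marking, in an integral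
symplectic frame `k₀ ∈ K_δ(1)`: «the level point named `x ∈ (ℤ/N)^{2g}` is `m₀.r w` whenever `k₀⁻¹ ŵ ≡ x̃/N`».  We move
the marking so that the frame becomes a PRINCIPAL representative:

* §1 `SiegelAdelicMarking.exists_of_isLatticeBasis` — re-indexing a marking along a change `a ↦ a′` of the adelic index
  with the same lattice (`Λ_a = Λ_{a′}`, same basis matrix), `exists_of_mul_mem_one` (`a′ = a k`, `k ∈ K_δ(1)`), and
  `exists_of_eq` (transport along an equality of complex structures `J = J′`): same `γ, Ψ, toFun`, hence the same
  torsion parametrisation `r`;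
* §2 **`adelicCongr_inv_mulVec_of_eq_mul_mul`** — THE LEVEL-`N` READING TRANSPORT (pure adelic algebra): if
  `k₀ = q_𝔸 · r · k` with `k ∈ K_δ(N)`, then `r⁻¹ v̂ ≡ x̃/N ⟹ k₀⁻¹ (q v)^ ≡ x̃/N` (★ R60-58
  `adelicCongr_coe_mul_inv_iff_of_mem_principalLevelSubgroup`: `K_δ(N)` acts trivially on `N`-torsion; ★
  `adelicCongr_rationalMove_iff`);
* §3 `SiegelAdelicMarking.exists_rationalMove_symplecticLatticeGroup` — the rational move by `M_ℚ`, `M ∈ Sp_δ(ℤ)`, of a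
  marking by `[J(Z₀), a₀]` is a marking by `[J(gDHom M • Z₀), M_𝔸 a₀]` with `r v = r₀ (M⁻¹ v)` (★ `rationalMove`, ★
  `conjAct_map_intCast_jOfSiegel`);
* §4 **`SiegelAdelicMarking.exists_principalRep_of_frame`** — THE B4 (c) HEAD: from `m₀` by `[J(Z₀), a₀]` (`a₀ ∈ K_δ(1)`)
  and a frame `k₀ ∈ K_δ(1)` one gets the (U3) data `(c, u, r)` (★ `exists_principalRep` clauses verbatim, `ν(k₀) = u`),
  `M ∈ Sp_δ(ℤ)`, the point `Z = gDHom M⁻¹ • Z₀ ∈ 𝔥_g` and a marking `m` of the SAME `A` by `[J(Z), r]` whose level-`N`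
  readings through `r` ARE the level-`N` readings of `m₀` through `k₀`:
  `r⁻¹ v̂ ≡ x̃/N ⟹ m.r v = m₀.r (M v) ∧ k₀⁻¹ (M v)^ ≡ x̃/N`; and the `hlevel`-shaped corollary
  `exists_principalRep_reading_eq` for any level-`N` naming `P : (ℤ/N)^{2g} → A(ℂ)` framed by `k₀`.

## References
* [Milne2005ShimuraVarieties] J. S. Milne, *Introduction to Shimura varieties* (2005), §5 Lemma 5.13 p. 57, Thm. 5.17 p. 59;
  §6 Thm. 6.11 pp. 74–75 («the triples of `[J, a]` and `[qJq⁻¹, qa]` coincide»; «`Λ_{au} = Λ_a` for `u ∈ K`»).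
* [Deligne1971TravauxShimura] P. Deligne, *Travaux de Shimura* (1971), 4.12 (b) pp. 148–149, Exemple 4.16 p. 150.
-/

set_option autoImplicit false

noncomputable section

open Matrix NumberField IsDedekindDomain CategoryTheory

namespace Literature.AlgebraicGeometry.ModuliOfAbelianVarieties

open Literature.AlgebraicGeometry.Motives (AbelianVariety)
open Literature.Geometry.Kaehler (ComplexTorus)
open Literature.NumberTheory.Adeles (latticeOfGL mem_latticeOfGL_one_iff)
open Literature.NumberTheory.Automorphic (siegelUpperHalfSpace)
open SiegelModuli

variable {g : ℕ} {δ : Fin g → ℕ}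

/-! ### §1. Re-indexing a marking: same lattice, or equal complex structures -/

namespace SiegelAdelicMarking

variable {J J' : C0pm δ} {a a' : gspFinAdelic δ} {A : AbelianVariety ℂ}

/-- **A marking by `[J, a]` is a marking by `[J, a′]` whenever `Λ_{a′} = Λ_a` with the same basis matrix** (the marking
data — lattice basis `γ`, complex chart `Ψ`, uniformisation — depend on `a` only through the lattice `Λ_a = γℤ^{2g}`);
the torsion parametrisations agree. [cite: Milne2005ShimuraVarieties, §6 Thm. 6.11 p. 74 and p. 75] -/
theorem exists_of_isLatticeBasis (m : SiegelAdelicMarking J a A) (h : IsLatticeBasis a' m.γ) :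
    ∃ m' : SiegelAdelicMarking J a' A, m'.γ = m.γ ∧ m'.Ψ = m.Ψ ∧ HEq m'.toFun m.toFun ∧ ∀ v, m'.r v = m.r v :=
  ⟨{ γ := m.γ
     γ_isLatticeBasis := h
     Ψ := m.Ψ
     Ψ_J := m.Ψ_J
     toFun := m.toFun
     isAnalytification := m.isAnalytification
     toFun_add := m.toFun_add }, rfl, rfl, HEq.rfl, fun _ => rfl⟩

/-- **`Λ_{ak} = Λ_a` for `k ∈ K_δ(1) = GSp_δ(ẑ)`** ([Milne ISV] §4: `Λ_{au} = Λ_a` for integral `u`; ★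
`IsLatticeBasis.mul_of_mem_principalLevelSubgroup_one`): a marking by `[J, a]` is a marking by `[J, a·k]` with the same
torsion parametrisation. [cite: Milne2005ShimuraVarieties, §4 pp. 48–49 and §6 p. 75] -/
theorem exists_of_mul_mem_one (m : SiegelAdelicMarking J a A) {k : gspFinAdelic δ} (hk : k ∈ principalLevelSubgroup δ 1) :
    ∃ m' : SiegelAdelicMarking J (a * k) A, m'.γ = m.γ ∧ m'.Ψ = m.Ψ ∧ HEq m'.toFun m.toFun ∧ ∀ v, m'.r v = m.r v :=
  m.exists_of_isLatticeBasis (m.γ_isLatticeBasis.mul_of_mem_principalLevelSubgroup_one hk)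

/-- Transport of a marking along an EQUALITY of complex structures `J = J′` (e.g. ★ `conjAct_map_intCast_jOfSiegel`:
`M_ℚ · J(Z) = J(gDHom M • Z)`); the torsion parametrisation is unchanged. [cite: Milne2005ShimuraVarieties, §6 Thm. 6.11 p. 74] -/
theorem exists_of_eq (e : J = J') (m : SiegelAdelicMarking J a A) :
    ∃ m' : SiegelAdelicMarking J' a A, m'.γ = m.γ ∧ m'.Ψ = m.Ψ ∧ HEq m'.toFun m.toFun ∧ ∀ v, m'.r v = m.r v := by
  subst e
  exact ⟨m, rfl, rfl, HEq.rfl, fun _ => rfl⟩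

end SiegelAdelicMarking

/-! ### §2. The level-`N` reading transport (pure adelic algebra) -/

/-- **Integral vectors are `≡ 0`**: if `b v̂ ≡ b′ ŵ` and `w` has integer coordinates while `b′ = 1`, then `b v̂ ≡ 0`,
i.e. `v ∈ Λ_{b⁻¹}` (★ R60-58 `AdelicCongr.of_sub_mem_latticeOfGL_right`, `adelicCongr_zero_right_iff`).
[cite: Milne2005ShimuraVarieties, §4 pp. 48–49] -/
theorem AdelicCongr.mem_latticeOfGL_of_int {b : GL (Fin g ⊕ Fin g) finAdeleQ} {v w : Fin g ⊕ Fin g → ℚ}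
    (h : AdelicCongr b 1 v w) (hw : ∀ i, ∃ z : ℤ, (z : ℚ) = w i) : v ∈ latticeOfGL b⁻¹ := by
  have hw' : w - 0 ∈ latticeOfGL ((1 : GL (Fin g ⊕ Fin g) finAdeleQ)⁻¹) := by
    rw [sub_zero, inv_one, mem_latticeOfGL_one_iff]; exact hw
  have h0 : AdelicCongr b 1 v 0 := by
    have := h.of_sub_mem_latticeOfGL_right (w' := 0) (by
      rw [zero_sub, inv_one]
      exact neg_mem ((mem_latticeOfGL_one_iff).2 hw))
    exact this
  exact adelicCongr_zero_right_iff.1 h0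

/-- **`N • v ∈ Λ_r` for a level-`N` point named through `r`**: if `r⁻¹ v̂ ≡ x̃/N (mod ẑ^{2g})` then `N v ∈ Λ_r`
(multiply by `N`: `r⁻¹ (Nv)^ ≡ x̃ ≡ 0`). [cite: Milne2005ShimuraVarieties, §6 Thm. 6.11 p. 74 and p. 75] -/
theorem AdelicCongr.nsmul_mem_latticeOfGL_of_level {N : ℕ} (hN : N ≠ 0) {r : gspFinAdelic δ}
    {x : Fin g ⊕ Fin g → ZMod N} {v : Fin g ⊕ Fin g → ℚ}
    (hv : AdelicCongr ((r⁻¹ : gspFinAdelic δ) : GL (Fin g ⊕ Fin g) finAdeleQ) 1 v (fun i => ((x i).val : ℚ) / N)) :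
    N • v ∈ latticeOfGL ((r : gspFinAdelic δ) : GL (Fin g ⊕ Fin g) finAdeleQ) := by
  have hN' : (N : ℚ) ≠ 0 := Nat.cast_ne_zero.2 hN
  have h := hv.nsmul N
  have hint : ∀ i, ∃ z : ℤ, (z : ℚ) = (N • fun i => ((x i).val : ℚ) / N) i := fun i =>
    ⟨(x i).val, by rw [Pi.smul_apply, nsmul_eq_mul, mul_div_cancel₀ _ hN', Int.cast_natCast]⟩
  have hmem := AdelicCongr.mem_latticeOfGL_of_int h hint
  rwa [Subgroup.coe_inv, inv_inv] at hmem

/-- **THE LEVEL-`N` READING TRANSPORT.**  Let `k₀ = q_𝔸 · r · k` in `GSp_δ(𝔸_f)` with `q ∈ GSp_δ(ℚ)` and `k ∈ K_δ(N)`.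
If `v ∈ ℚ^{2g}` names the level point `x ∈ (ℤ/N)^{2g}` through `r` (`r⁻¹ v̂ ≡ x̃/N (mod ẑ^{2g})`), then `q v` names the SAME
`x` through `k₀` (`k₀⁻¹ (qv)^ ≡ x̃/N`): `k₀⁻¹ (qv)^ = k⁻¹ r⁻¹ v̂` (★ `adelicCongr_rationalMove_iff`) and `k⁻¹ ∈ K_δ(N)` acts
trivially on `N⁻¹Λ_r` (★ R60-58 `adelicCongr_coe_mul_inv_iff_of_mem_principalLevelSubgroup`) — Milne's «the level
structures correspond EXACTLY, independently of the representative of the class in `K`».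
[cite: Milne2005ShimuraVarieties, §6 Thm. 6.11 p. 74 and p. 75] [cite: Deligne1971TravauxShimura, 4.12 (b) pp. 148–149] -/
theorem adelicCongr_inv_mulVec_of_eq_mul_mul {N : ℕ} (hN : N ≠ 0) {k₀ r k : gspFinAdelic δ} (q : gspRational δ)
    (heq : k₀ = gspRationalToFinAdelic δ q * r * k) (hk : k ∈ principalLevelSubgroup δ N)
    {x : Fin g ⊕ Fin g → ZMod N} {v : Fin g ⊕ Fin g → ℚ}
    (hv : AdelicCongr ((r⁻¹ : gspFinAdelic δ) : GL (Fin g ⊕ Fin g) finAdeleQ) 1 v (fun i => ((x i).val : ℚ) / N)) :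
    AdelicCongr ((k₀⁻¹ : gspFinAdelic δ) : GL (Fin g ⊕ Fin g) finAdeleQ) 1
      ((((q : gspRational δ) : GL (Fin g ⊕ Fin g) ℚ) : Matrix (Fin g ⊕ Fin g) (Fin g ⊕ Fin g) ℚ) *ᵥ v)
      (fun i => ((x i).val : ℚ) / N) := by
  -- `k₀ = q_𝔸 (r k)`; move `q` across: `k₀⁻¹ (q v)^ = (r k)⁻¹ v̂`
  have heq' : k₀ = gspRationalToFinAdelic δ q * (r * k) := by rw [heq, mul_assoc]
  rw [heq', SiegelAdelicMarking.adelicCongr_rationalMove_iff, Matrix.mulVec_mulVec, ← Units.val_mul, inv_mul_cancel,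
    Units.val_one, Matrix.one_mulVec, _root_.mul_inv_rev]
  -- `k⁻¹ ∈ K_δ(N)` acts trivially on `N⁻¹ Λ_r`
  exact (adelicCongr_coe_mul_inv_iff_of_mem_principalLevelSubgroup (inv_mem hk)
    (AdelicCongr.nsmul_mem_latticeOfGL_of_level hN hv)).2 hv

/-! ### §3. The move of a marking by an integral symplectic matrix -/

namespace SiegelAdelicMarking

/-- **The rational move by `M ∈ Sp_δ(ℤ)` lands on the Siegel point `gDHom M • Z₀`**: a marking of `A` by `[J(Z₀), a₀]` gives
a marking of the same `A` by `[J(gDHom M • Z₀), M_𝔸 · a₀]` with torsion parametrisation `v ↦ r₀ (M⁻¹ v)` and basis matrix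
`M_ℚ · γ₀` (★ `rationalMove` + ★ `conjAct_map_intCast_jOfSiegel`). [cite: Milne2005ShimuraVarieties, §6 Thm. 6.11 p. 74 and p. 75]
[cite: Deligne1971TravauxShimura, 4.12 (b) pp. 148–149] -/
theorem exists_rationalMove_symplecticLatticeGroup (hδ : ∀ i, 0 < δ i) {A : AbelianVariety ℂ}
    (Z₀ : siegelUpperHalfSpace g) {a₀ : gspFinAdelic δ}
    (m₀ : SiegelAdelicMarking ⟨jOfSiegel δ Z₀, jOfSiegel_coe_mem_C0pm hδ Z₀⟩ a₀ A)
    (M : GL (Fin g ⊕ Fin g) ℤ) (hM : M ∈ symplecticLatticeGroup δ) :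
    ∃ m : SiegelAdelicMarking ⟨jOfSiegel δ ((gDHom δ hδ ⟨M, hM⟩ • Z₀ : siegelUpperHalfSpace g) : Matrix (Fin g) (Fin g) ℂ),
          jOfSiegel_coe_mem_C0pm hδ (gDHom δ hδ ⟨M, hM⟩ • Z₀)⟩
        (gspRationalToFinAdelic δ ⟨Matrix.GeneralLinearGroup.map (Int.castRingHom ℚ) M,
          map_mem_gspRational_of_mem_symplecticLatticeGroup δ hM⟩ * a₀) A,
      m.γ = Matrix.GeneralLinearGroup.map (Int.castRingHom ℚ) M * m₀.γ ∧ m.Ψ = m₀.Ψ ∧ HEq m.toFun m₀.toFun ∧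
        ∀ v, m.r v = m₀.r ((((Matrix.GeneralLinearGroup.map (Int.castRingHom ℚ) M)⁻¹ : GL (Fin g ⊕ Fin g) ℚ) :
          Matrix (Fin g ⊕ Fin g) (Fin g ⊕ Fin g) ℚ) *ᵥ v) := by
  set q : gspRational δ := ⟨Matrix.GeneralLinearGroup.map (Int.castRingHom ℚ) M,
    map_mem_gspRational_of_mem_symplecticLatticeGroup δ hM⟩ with hq
  have hJ := conjAct_map_intCast_jOfSiegel hδ ⟨M, hM⟩ Z₀
  obtain ⟨m, hγ, hΨ, hto, hr⟩ := exists_of_eq hJ (m₀.rationalMove q)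
  refine ⟨m, ?_, ?_, ?_, fun v => ?_⟩
  · rw [hγ, rationalMove_γ]
  · rw [hΨ, rationalMove_Ψ]
  · exact hto.trans (heq_of_eq (m₀.rationalMove_toFun q))
  · rw [hr, rationalMove_r]

end SiegelAdelicMarking

/-! ### §4. The B4 (c) head: transport to a principal representative with the same level-`N` readings -/

namespace SiegelAdelicMarking

/-- **TRANSPORT OF A LEVEL-ONE MARKING TO A PRINCIPAL REPRESENTATIVE** ([Milne ISV] Lemma 5.13 «`a = qgk`» applied inside
Thm. 6.11's dictionary; B4 (c)).  Let `δ` be a polarisation type, `0 < g`, `N ≠ 0`; let `A` be marked by `[J(Z₀), a₀]` with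
`a₀ ∈ K_δ(1)` (`m₀`), and let `k₀ ∈ K_δ(1)` (the integral symplectic frame in which a given liftable level structure reads
through `m₀`).  Then there are the (U3) data — `c ∈ (ℤ/N)^×`, a `ẑ`-unit `u ≡ c (mod N)`, the principal representative
`r = diag(1_g, u·1_g) ∈ K_δ(1)` of multiplier `u` (clauses of ★ `exists_principalRep` verbatim), with `ν(k₀) = u` — an
integral symplectic `M ∈ Sp_δ(ℤ)`, the Siegel point `Z = gDHom M⁻¹ • Z₀`, and a marking `m` of the SAME `A` by `[J(Z), r]`
(same uniformisation and complex chart as `m₀`, basis matrix `M⁻¹_ℚ γ₀`) such that, for every `x ∈ (ℤ/N)^{2g}` and every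
`v` naming `x` through `r` (`r⁻¹ v̂ ≡ x̃/N`), `m.r v = m₀.r (M v)` and `M v` names `x` through `k₀` (`k₀⁻¹ (Mv)^ ≡ x̃/N`).
Proof: FILE 1 `k₀ = M_𝔸 · r · k`; move `m₀` by `M⁻¹_ℚ` (§3); re-index `M⁻¹_𝔸 a₀ ↦ r` inside `K_δ(1)` (§1); §2 for the readings.
[cite: Milne2005ShimuraVarieties, §5 Lemma 5.13 p. 57; §6 Thm. 6.11 pp. 74–75] [cite: Deligne1971TravauxShimura, 4.12 (b) pp. 148–149 and 4.16 p. 150] -/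
theorem exists_principalRep_of_frame (hδ : IsPolarizationType δ) (hg : 0 < g) {N : ℕ} (hN : N ≠ 0)
    {A : AbelianVariety ℂ} (Z₀ : siegelUpperHalfSpace g) {a₀ : gspFinAdelic δ} (ha₀ : a₀ ∈ principalLevelSubgroup δ 1)
    (m₀ : SiegelAdelicMarking ⟨jOfSiegel δ Z₀, jOfSiegel_coe_mem_C0pm hδ.1 Z₀⟩ a₀ A)
    (k₀ : gspFinAdelic δ) (hk₀ : k₀ ∈ principalLevelSubgroup δ 1) :
    ∃ (c : (ZMod N)ˣ) (u : finAdeleQˣ) (r : gspFinAdelic δ) (M : GL (Fin g ⊕ Fin g) ℤ) (hM : M ∈ symplecticLatticeGroup δ)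
      (m : SiegelAdelicMarking
        ⟨jOfSiegel δ ((gDHom δ hδ.1 ⟨M⁻¹, inv_mem hM⟩ • Z₀ : siegelUpperHalfSpace g) : Matrix (Fin g) (Fin g) ℂ),
          jOfSiegel_coe_mem_C0pm hδ.1 (gDHom δ hδ.1 ⟨M⁻¹, inv_mem hM⟩ • Z₀)⟩ r A),
      (∀ v, Valued.v ((u : finAdeleQ) v) = 1) ∧
      (u : finAdeleQ) - ((c : ZMod N).val : ℕ) ∈ levelIdeal N ∧
      r ∈ principalLevelSubgroup δ 1 ∧
      IsMultiplier (typeFormOver δ finAdeleQ) (r : GL (Fin g ⊕ Fin g) finAdeleQ) u ∧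
      ((r : GL (Fin g ⊕ Fin g) finAdeleQ) : Matrix (Fin g ⊕ Fin g) (Fin g ⊕ Fin g) finAdeleQ) =
        Matrix.fromBlocks 1 0 0 ((u : finAdeleQ) • (1 : Matrix (Fin g) (Fin g) finAdeleQ)) ∧
      IsMultiplier (typeFormOver δ finAdeleQ) (k₀ : GL (Fin g ⊕ Fin g) finAdeleQ) u ∧
      m.Ψ = m₀.Ψ ∧ HEq m.toFun m₀.toFun ∧
      m.γ = ((Matrix.GeneralLinearGroup.map (Int.castRingHom ℚ) M)⁻¹ : GL (Fin g ⊕ Fin g) ℚ) * m₀.γ ∧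
      ∀ (x : Fin g ⊕ Fin g → ZMod N) (v : Fin g ⊕ Fin g → ℚ),
        AdelicCongr ((r⁻¹ : gspFinAdelic δ) : GL (Fin g ⊕ Fin g) finAdeleQ) 1 v (fun i => ((x i).val : ℚ) / N) →
          m.r v = m₀.r (((Matrix.GeneralLinearGroup.map (Int.castRingHom ℚ) M : GL (Fin g ⊕ Fin g) ℚ) :
              Matrix (Fin g ⊕ Fin g) (Fin g ⊕ Fin g) ℚ) *ᵥ v) ∧
            AdelicCongr ((k₀⁻¹ : gspFinAdelic δ) : GL (Fin g ⊕ Fin g) finAdeleQ) 1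
              (((Matrix.GeneralLinearGroup.map (Int.castRingHom ℚ) M : GL (Fin g ⊕ Fin g) ℚ) :
                Matrix (Fin g ⊕ Fin g) (Fin g ⊕ Fin g) ℚ) *ᵥ v)
              (fun i => ((x i).val : ℚ) / N) := by
  -- FILE 1: `k₀ = M_𝔸 · r · k`
  obtain ⟨M, hM, c, u, r, k, hu, hc, hr, hru, hrmat, hν, hk, heq⟩ :=
    exists_symplecticLatticeGroup_mul_principalRep_mul_level_of_mem_one δ hδ hg hN k₀ hk₀
  have hmap : Matrix.GeneralLinearGroup.map (Int.castRingHom ℚ) (M⁻¹) =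
      (Matrix.GeneralLinearGroup.map (Int.castRingHom ℚ) M)⁻¹ := map_inv _ _
  -- the rational point `M⁻¹_ℚ` lies adelically in `K_δ(1)`
  have hq1 : gspRationalToFinAdelic δ ⟨Matrix.GeneralLinearGroup.map (Int.castRingHom ℚ) (M⁻¹),
      map_mem_gspRational_of_mem_symplecticLatticeGroup δ (inv_mem hM)⟩ ∈ principalLevelSubgroup δ 1 :=
    (map_mem_principalLevelSubgroup_iff_mem_siegelLevelGroup one_ne_zero (inv_mem hM)).2
      (by rw [siegelLevelGroup_one]; exact inv_mem hM)
  -- the move by `M⁻¹`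
  obtain ⟨m₁, hγ₁, hΨ₁, hto₁, hr₁⟩ := m₀.exists_rationalMove_symplecticLatticeGroup hδ.1 Z₀ (M⁻¹) (inv_mem hM)
  -- the adelic index `M⁻¹_𝔸 a₀` and `r` define the same lattice: re-index inside `K_δ(1)`
  have hk1 : (gspRationalToFinAdelic δ ⟨Matrix.GeneralLinearGroup.map (Int.castRingHom ℚ) (M⁻¹),
      map_mem_gspRational_of_mem_symplecticLatticeGroup δ (inv_mem hM)⟩ * a₀)⁻¹ * r ∈ principalLevelSubgroup δ 1 :=
    mul_mem (inv_mem (mul_mem hq1 ha₀)) hr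
  have hbasis : IsLatticeBasis r m₁.γ := by
    have h := m₁.γ_isLatticeBasis.mul_of_mem_principalLevelSubgroup_one hk1
    rwa [mul_inv_cancel_left] at h
  obtain ⟨m', hγ', hΨ', hto', hr''⟩ := m₁.exists_of_isLatticeBasis hbasis
  refine ⟨c, u, r, M, hM, m', hu, hc, hr, hru, hrmat, hν, ?_, ?_, ?_, fun x v hv => ?_⟩
  · exact hΨ'.trans hΨ₁
  · exact hto'.trans hto₁
  · exact hγ'.trans (hγ₁.trans (by rw [hmap]))
  · have hread := adelicCongr_inv_mulVec_of_eq_mul_mul hN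
      ⟨Matrix.GeneralLinearGroup.map (Int.castRingHom ℚ) M, map_mem_gspRational_of_mem_symplecticLatticeGroup δ hM⟩
      heq hk hv
    refine ⟨?_, hread⟩
    have e := (hr'' v).trans (hr₁ v)
    rw [hmap, inv_inv] at e
    exact e

/-- **`hlevel` TRANSPORT** (the shape B4 (b)/(d) consume): if a level-`N` naming `P : (ℤ/N)^{2g} → A(ℂ)` is framed by `k₀`
through `m₀` (`k₀⁻¹ ŵ ≡ x̃/N ⟹ P x = m₀.r w` — e.g. `P x = Λ₀.lift N x` for a symplectic lift `Λ₀` of the given level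
structure), then with the data of `exists_principalRep_of_frame` it is framed by the principal representative `r` through
`m`: `r⁻¹ v̂ ≡ x̃/N ⟹ P x = m.r v`. [cite: Milne2005ShimuraVarieties, §6 Thm. 6.11 pp. 74–75] [cite: Deligne1971TravauxShimura, 4.12 (b) pp. 148–149] -/
theorem exists_principalRep_reading_eq (hδ : IsPolarizationType δ) (hg : 0 < g) {N : ℕ} (hN : N ≠ 0)
    {A : AbelianVariety ℂ} (Z₀ : siegelUpperHalfSpace g) {a₀ : gspFinAdelic δ} (ha₀ : a₀ ∈ principalLevelSubgroup δ 1)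
    (m₀ : SiegelAdelicMarking ⟨jOfSiegel δ Z₀, jOfSiegel_coe_mem_C0pm hδ.1 Z₀⟩ a₀ A)
    (k₀ : gspFinAdelic δ) (hk₀ : k₀ ∈ principalLevelSubgroup δ 1)
    (P : (Fin g ⊕ Fin g → ZMod N) → A.Points ℂ)
    (hP : ∀ (x : Fin g ⊕ Fin g → ZMod N) (w : Fin g ⊕ Fin g → ℚ),
      AdelicCongr ((k₀⁻¹ : gspFinAdelic δ) : GL (Fin g ⊕ Fin g) finAdeleQ) 1 w (fun i => ((x i).val : ℚ) / N) →
        P x = m₀.r w) :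
    ∃ (c : (ZMod N)ˣ) (u : finAdeleQˣ) (r : gspFinAdelic δ) (Z : siegelUpperHalfSpace g)
      (m : SiegelAdelicMarking ⟨jOfSiegel δ (Z : Matrix (Fin g) (Fin g) ℂ), jOfSiegel_coe_mem_C0pm hδ.1 Z⟩ r A),
      (∀ v, Valued.v ((u : finAdeleQ) v) = 1) ∧
      (u : finAdeleQ) - ((c : ZMod N).val : ℕ) ∈ levelIdeal N ∧
      r ∈ principalLevelSubgroup δ 1 ∧
      IsMultiplier (typeFormOver δ finAdeleQ) (r : GL (Fin g ⊕ Fin g) finAdeleQ) u ∧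
      ((r : GL (Fin g ⊕ Fin g) finAdeleQ) : Matrix (Fin g ⊕ Fin g) (Fin g ⊕ Fin g) finAdeleQ) =
        Matrix.fromBlocks 1 0 0 ((u : finAdeleQ) • (1 : Matrix (Fin g) (Fin g) finAdeleQ)) ∧
      IsMultiplier (typeFormOver δ finAdeleQ) (k₀ : GL (Fin g ⊕ Fin g) finAdeleQ) u ∧
      m.Ψ = m₀.Ψ ∧ HEq m.toFun m₀.toFun ∧
      ∀ (x : Fin g ⊕ Fin g → ZMod N) (v : Fin g ⊕ Fin g → ℚ),
        AdelicCongr ((r⁻¹ : gspFinAdelic δ) : GL (Fin g ⊕ Fin g) finAdeleQ) 1 v (fun i => ((x i).val : ℚ) / N) →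
          P x = m.r v := by
  obtain ⟨c, u, r, M, hM, m, hu, hc, hr, hru, hrmat, hν, hΨ, hto, -, hread⟩ :=
    exists_principalRep_of_frame hδ hg hN Z₀ ha₀ m₀ k₀ hk₀
  refine ⟨c, u, r, _, m, hu, hc, hr, hru, hrmat, hν, hΨ, hto, fun x v hv => ?_⟩
  obtain ⟨h1, h2⟩ := hread x v hv
  rw [h1]
  exact hP x _ h2

end SiegelAdelicMarking

end Literature.AlgebraicGeometry.ModuliOfAbelianVarieties

end
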